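import Summits.AnomalousDissipation.AnomalousDissipation.Theorems.SawtoothPulseCascadeK2InjectionPerpSlot
import Literature.Analysis.FluidPDE.TorusLinearisedNSStreamwiseHarmonics
import Literature.Analysis.FluidPDE.SawtoothCascadeSlotDamping
import Literature.Analysis.FunctionSpaces.TorusSobolevNorm

/-!
# K2″ injection phase: the perpendicular-slot estimate REDUCED TO ONE STREAMWISE HARMONIC of the comb
(route `AnomalousDissipation/SawtoothPulseCascade`, crux K2″ = stmt-AnomalousDissipation-19696
`K2LinearisedCascadeGrowth`, registered line `phase-cocycle` (skeleton 0c87d78a), stub A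
`stub_injectionPhase`; helper, `--supports`; sequel of `…K2InjectionPerpSlot`)

`…K2InjectionPerpSlot.injectionPhase_of_perpSlot_Ioc` (p793536) closes the registered stub A modulo ONE
estimate: on the V half-slot `[tStart j₀ + tHalf j₀, tStart (j₀+1)]` of phase `j₀`, every classical
linearised response started from a HORIZONTAL residual comb `w₁ = g(x₂) e₁` of frequency `N_{j₀}` is
amplified in `L²`-energy by at most `(3e^{σ⋆γ})²`, for `γ ∈ (5.77, 8]`.  On that slot the cascade carrier is
the vertical shear `(0, rateV j₀ t · U j₀ (x₁))` — invariant under the translations along `e₁`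
(`field_add_single_one_of_mem_V`) — and `w₁` depends on `x₂` alone, i.e. its Fourier spectrum lies on the
axis `ℤ e₁`, with coefficients only at the ODD multiples of `N_{j₀}`.  The tree's per-streamwise-mode
reduction (`Torus.linearisedNS_integral_norm_sq_le_of_forall_harmonic`, ad-lit: Drazin §8.1 normal modes made
classical) therefore applies, and this file records the outcome in the stub's own vocabulary:

* §1 the datum side — a horizontal comb `g(x₂) e₁` has zero mean (`hasZeroMean_combH`), Fourier
  coefficients supported on the axis `ℤ e₁` (`mFourierCoeff_combH_eq_zero_of_ne`), and NO coefficient at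
  `l e₁` unless `l` is an odd multiple of `N` (`mFourierCoeff_combH_single_eq_zero`);
* §2 `perpSlot_of_harmonics` — pointwise in `P` (`δ₀ > 0`, `d > 0`), `ν > 0`, `j₀`, `0 ≤ C`: if every
  classical linearised response on the V half-slot of phase `j₀` launched from a SINGLE transversal harmonic
  `Re (e_{l e₁}(x) z)` (`z ∈ ℂ²`, `z₁ = 0`; i.e. `(cos(2πl x₂) Re z₀ − sin(2πl x₂) Im z₀) e₁`) at an odd
  multiple `l = (2n+1) N_{j₀} ≥ 1` obeys `‖W(t)‖² ≤ C ‖W(tStart j₀ + tHalf j₀)‖²` on the slot, then so does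
  every response started from a horizontal residual comb of frequency `N_{j₀}` (harmonics of the comb that
  vanish launch the zero solution, `Torus.linearisedNS_eq_zero`);
* §3 `injectionPhase_of_harmonics` — **the registered stub A VERBATIM** from that single-harmonic bound with
  `C = (3e^{σ⋆γ})²` on the residual range `γ ∈ (5.77, 8]`, `ρN ∈ {2,…,7}` (via
  `injectionPhase_of_perpSlot_Ioc`).

So the open content of `stub_injectionPhase` is now ONE streamwise harmonic at a time: the classical
Orr–Sommerfeld initial-value problem of the rounded, viscous, finite-time V pulse of phase `j₀` at the
modally NEUTRAL relative wavenumbers `a = l/N_{j₀} ∈ {1, 3, 5, …}` (`sawC2zero_natCast_pos`), datum = the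
pure streamwise mode (cross-stream wavenumber `0`), `L²` amplification `≤ 9e^{2σ⋆γ}` uniformly in `j₀` and
`ν ≤ ν₀` — against the crude `e^{γ}` it must win a factor `≤ 21/9`.  Nothing here claims that bound.
-/

-- `Summit.<Summit>.<Problem>` is the tree's mandated summit-side namespace (CONVENTIONS §2); for this
-- single-conjunct summit the two coincide, so the duplicate is deliberate (lakefile: off for `Summits`).
set_option linter.dupNamespace false

noncomputable section

namespace Summit.AnomalousDissipation.AnomalousDissipation.Theorems.SawtoothPulseCascade.K2Classical

open Set MeasureTheory UnitAddTorus
open scoped ContDiff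
open Literature.Analysis Literature.Analysis.FunctionSpaces Literature.Analysis.FluidPDE
open Literature.Analysis.FluidPDE.SawtoothCascade
open Literature.Analysis.FluidPDE.SawtoothCascade.CascadeParams

/-! ## §1 The datum side: a horizontal comb `g(x₂) e₁` on `𝕋²` -/

section Datum

variable {N : ℕ} {g : ℝ → ℝ} (hg : ContDiff ℝ ∞ g) (hper : Function.Periodic g 1)
  (hmom : ∀ m : ℤ, (¬ ∃ n : ℤ, m = (2 * n + 1) * (N : ℤ)) →
    (∫ y in (0 : ℝ)..1, g y * Real.cos (2 * Real.pi * m * y)) = 0 ∧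
    (∫ y in (0 : ℝ)..1, g y * Real.sin (2 * Real.pi * m * y)) = 0)

/-- The descended complex profile `𝕋 → ℂ` of a continuous `1`-periodic `g`. -/
private theorem continuous_liftIco_comb (hg : ContDiff ℝ ∞ g) (hper : Function.Periodic g 1) :
    Continuous (AddCircle.liftIco 1 0 (fun y => (g y : ℂ))) :=
  continuous_liftIco_of_periodic (Complex.continuous_ofReal.comp hg.continuous) (fun y => by simp [hper y])

include hg hmom in
/-- The circle coefficients of a comb profile vanish off the odd multiples of `N`. -/
theorem fourierCoeff_comb_eq_zero {m : ℤ} (hm : ¬ ∃ n : ℤ, m = (2 * n + 1) * (N : ℤ)) :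
    fourierCoeff (AddCircle.liftIco 1 0 (fun y => (g y : ℂ))) m = 0 :=
  (fourierCoeff_liftIco_ofReal_eq_zero_iff hg.continuous m).2 (hmom m hm)

/-- First component of the complexified horizontal comb: the descended profile read at `x₂`. -/
private theorem combH_apply_zero (g : ℝ → ℝ) :
    (fun x : UnitAddTorus (Fin 2) =>
        (((g (Torus.repr x 1) • EuclideanSpace.single (0 : Fin 2) (1 : ℝ)) 0 : ℝ) : ℂ)) =
      fun x => AddCircle.liftIco 1 0 (fun y => (g y : ℂ)) (x 1) := by
  funext x
  have h1 : ((g (Torus.repr x 1) • EuclideanSpace.single (0 : Fin 2) (1 : ℝ)) 0 : ℝ) = g (Torus.repr x 1) := by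
    simp
  rw [h1]
  rfl

/-- Second component of the horizontal comb: zero. -/
private theorem combH_apply_one (g : ℝ → ℝ) :
    (fun x : UnitAddTorus (Fin 2) =>
        (((g (Torus.repr x 1) • EuclideanSpace.single (0 : Fin 2) (1 : ℝ)) 1 : ℝ) : ℂ)) =
      fun _ => (0 : ℂ) := by
  funext x
  simp

/-- The coefficients of the zero scalar function vanish. -/
private theorem mFourierCoeff_const_zero (k : Fin 2 → ℤ) :
    mFourierCoeff (fun _ : UnitAddTorus (Fin 2) => (0 : ℂ)) k = 0 := by
  simp [mFourierCoeff]

/-- A horizontal comb field is integrable (continuous on the compact torus). -/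
private theorem integrable_combH (hg : ContDiff ℝ ∞ g) (hper : Function.Periodic g 1) :
    Integrable (fun x : UnitAddTorus (Fin 2) => g (Torus.repr x 1) • EuclideanSpace.single (0 : Fin 2) (1 : ℝ))
      volume :=
  (isSmooth_coordFun_combH hg hper).integrable
where
  /-- smoothness of the horizontal comb field (tree `isSmooth_parallelShear`-type fact, via `K2Classical`). -/
  isSmooth_coordFun_combH (hg : ContDiff ℝ ∞ g) (hper : Function.Periodic g 1) :
      Torus.IsSmooth (fun x : UnitAddTorus (Fin 2) =>
        g (Torus.repr x 1) • EuclideanSpace.single (0 : Fin 2) (1 : ℝ)) :=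
    isSmooth_parallelShear hper hg

include hg hper in
/-- **Axis support.** The Fourier coefficients of the horizontal comb `g(x₂) e₁` vanish off the axis `ℤ e₁`
(`k₀ ≠ 0`): the field is a function of `x₂` alone (`Torus.mFourierCoeff_comp_eval_eq_zero`). -/
theorem mFourierCoeff_combH_eq_zero_of_ne {k : Fin 2 → ℤ} (hk : k 0 ≠ 0) :
    mFourierCoeff (EuclideanSpace.complexify ∘ fun x : UnitAddTorus (Fin 2) =>
        g (Torus.repr x 1) • EuclideanSpace.single (0 : Fin 2) (1 : ℝ)) k = 0 := by
  have hint := integrable_combH hg hper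
  ext i
  rw [Torus.mFourierCoeff_complexify_apply hint k i]
  fin_cases i
  · show mFourierCoeff (fun x : UnitAddTorus (Fin 2) =>
        (((g (Torus.repr x 1) • EuclideanSpace.single (0 : Fin 2) (1 : ℝ)) 0 : ℝ) : ℂ)) k = (0 : EuclideanSpace ℂ (Fin 2)) 0
    rw [combH_apply_zero g]
    simpa using Torus.mFourierCoeff_comp_eval_eq_zero (d := Fin 2)
      (AddCircle.liftIco 1 0 (fun y => (g y : ℂ))) 1 (l := 0) (by decide) hk
  · show mFourierCoeff (fun x : UnitAddTorus (Fin 2) =>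
        (((g (Torus.repr x 1) • EuclideanSpace.single (0 : Fin 2) (1 : ℝ)) 1 : ℝ) : ℂ)) k = (0 : EuclideanSpace ℂ (Fin 2)) 1
    rw [combH_apply_one g, mFourierCoeff_const_zero]
    simp

include hg hper hmom in
/-- **Comb support on the axis.** The coefficient of the horizontal comb `g(x₂) e₁` at `l e₁` vanishes unless
`l` is an odd multiple of `N` (`Torus.mFourierCoeff_comp_eval_single` + the moments of `ShearCombDatum`). -/
theorem mFourierCoeff_combH_single_eq_zero {l : ℤ} (hl : ¬ ∃ n : ℤ, l = (2 * n + 1) * (N : ℤ)) :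
    mFourierCoeff (EuclideanSpace.complexify ∘ fun x : UnitAddTorus (Fin 2) =>
        g (Torus.repr x 1) • EuclideanSpace.single (0 : Fin 2) (1 : ℝ)) (Pi.single 1 l) = 0 := by
  have hint := integrable_combH hg hper
  ext i
  rw [Torus.mFourierCoeff_complexify_apply hint _ i]
  fin_cases i
  · show mFourierCoeff (fun x : UnitAddTorus (Fin 2) =>
        (((g (Torus.repr x 1) • EuclideanSpace.single (0 : Fin 2) (1 : ℝ)) 0 : ℝ) : ℂ)) (Pi.single 1 l) =
        (0 : EuclideanSpace ℂ (Fin 2)) 0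
    rw [combH_apply_zero g, Torus.mFourierCoeff_comp_eval_single (d := Fin 2) (continuous_liftIco_comb hg hper) 1 l,
      fourierCoeff_comb_eq_zero hg hmom hl]
    simp
  · show mFourierCoeff (fun x : UnitAddTorus (Fin 2) =>
        (((g (Torus.repr x 1) • EuclideanSpace.single (0 : Fin 2) (1 : ℝ)) 1 : ℝ) : ℂ)) (Pi.single 1 l) =
        (0 : EuclideanSpace ℂ (Fin 2)) 1
    rw [combH_apply_one g, mFourierCoeff_const_zero]
    simp

include hg hper hmom in
/-- **Zero mean.** A horizontal comb of frequency `N ≠ 0` has zero mean (`0` is not an odd multiple of `N`). -/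
theorem hasZeroMean_combH (hN : N ≠ 0) :
    Torus.HasZeroMean (fun x : UnitAddTorus (Fin 2) =>
      g (Torus.repr x 1) • EuclideanSpace.single (0 : Fin 2) (1 : ℝ)) := by
  have h0 : ¬ ∃ n : ℤ, (0 : ℤ) = (2 * n + 1) * (N : ℤ) := by
    rintro ⟨n, hn⟩
    have hN' : (N : ℤ) ≠ 0 := by exact_mod_cast hN
    have h2 : (2 * n + 1 : ℤ) ≠ 0 := by omega
    exact (mul_ne_zero h2 hN') hn.symm
  have h1 : mFourierCoeff (fun x : UnitAddTorus (Fin 2) => ((g (Torus.repr x 1) : ℝ) : ℂ)) (Pi.single 1 0) =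
      fourierCoeff (AddCircle.liftIco 1 0 (fun y => (g y : ℂ))) 0 := by
    have hfun : (fun x : UnitAddTorus (Fin 2) => ((g (Torus.repr x 1) : ℝ) : ℂ)) =
        fun x => AddCircle.liftIco 1 0 (fun y => (g y : ℂ)) (x 1) := by
      funext x; rfl
    rw [hfun]
    exact Torus.mFourierCoeff_comp_eval_single (d := Fin 2) (continuous_liftIco_comb hg hper) 1 0
  rw [Pi.single_zero, Torus.mFourierCoeff_zero_eq_integral, fourierCoeff_comb_eq_zero hg hmom h0,
    integral_complex_ofReal] at h1
  have hint : ∫ x : UnitAddTorus (Fin 2), g (Torus.repr x 1) = 0 := by exact_mod_cast h1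
  unfold Torus.HasZeroMean
  rw [integral_smul_const, hint, zero_smul]

end Datum

/-! ## §2 The perpendicular-slot bound from single streamwise harmonics (pointwise) -/

/-- In `ℤ²`, a frequency off the normal form `k = k₁ e₁` has `k₀ ≠ 0`. -/
private theorem apply_zero_ne_zero_of_ne_single {k : Fin 2 → ℤ} (hk : k ≠ Pi.single 1 (k 1)) : k 0 ≠ 0 := by
  intro h0
  apply hk
  funext i
  fin_cases i
  · simpa using h0
  · simp

/-- A single real mode with the zero vector is the zero field. -/
private theorem realTrigPoly_singleton_zero (k : Fin 2 → ℤ) :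
    Torus.realTrigPoly {k} (fun _ => (0 : EuclideanSpace ℂ (Fin 2))) = 0 := by
  funext x
  rw [Torus.realTrigPoly_singleton_apply]
  simp

/-- **The perpendicular-slot bound from single harmonics (pointwise).**  Let `δ₀ > 0`, `d > 0`, `ν > 0`,
`N_{j₀} ≠ 0`, `0 ≤ C`, and assume: for every `l ≥ 1` that is an odd multiple of `N_{j₀}` and every
transversal vector `z ∈ ℂ²` (`z₁ = 0`), every classical linearised response `(W, Q)` on the V half-slot of
phase `j₀` launched from the single streamwise harmonic `Re (e_{l e₁} z)` obeys
`‖W(t)‖² ≤ C ‖W(tStart j₀ + tHalf j₀)‖²` on the slot.  Then every classical linearised response on that slot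
started from a horizontal residual comb `w₁` of frequency `N_{j₀}` obeys `‖w(t)‖² ≤ C ‖w₁‖²` on the slot.
(The tree's `Torus.linearisedNS_integral_norm_sq_le_of_forall_harmonic` on the `e₁`-invariant V pulse; the
harmonics `l ∉ (2ℤ+1)N_{j₀}` of the comb are absent, so they launch the zero solution.) -/
theorem perpSlot_of_harmonics (P : CascadeParams) (hδ₀ : 0 < P.δ₀) (hd : 0 < P.d) {ν : ℝ} (hν : 0 < ν)
    (j₀ : ℕ) (hN : P.N j₀ ≠ 0) {C : ℝ} (hC : 0 ≤ C)
    (hH : ∀ l : ℕ, 1 ≤ l → (∃ n : ℤ, (l : ℤ) = (2 * n + 1) * (P.N j₀ : ℤ)) →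
      ∀ z : EuclideanSpace ℂ (Fin 2), z 1 = 0 →
      ∀ (W : ℝ → UnitAddTorus (Fin 2) → EuclideanSpace ℝ (Fin 2)) (Q : ℝ → UnitAddTorus (Fin 2) → ℝ),
      Torus.IsSmoothSpaceTimeOn (Icc (tStart j₀ + tHalf j₀) (tStart (j₀ + 1))) W →
      Torus.IsSmoothSpaceTimeOn (Icc (tStart j₀ + tHalf j₀) (tStart (j₀ + 1))) Q →
      (∀ s ∈ Icc (tStart j₀ + tHalf j₀) (tStart (j₀ + 1)), Torus.IsDivFree (W s)) →
      (∀ s ∈ Icc (tStart j₀ + tHalf j₀) (tStart (j₀ + 1)), ∀ x,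
        Torus.timeDerivWithin (Icc (tStart j₀ + tHalf j₀) (tStart (j₀ + 1))) W s x +
          Torus.convect (P.field s) (W s) x + Torus.convect (W s) (P.field s) x =
            ν • Torus.laplacian (W s) x - Torus.gradient (Q s) x) →
      W (tStart j₀ + tHalf j₀) = Torus.realTrigPoly {Pi.single 1 (l : ℤ)} (fun _ => z) →
      ∀ t ∈ Icc (tStart j₀ + tHalf j₀) (tStart (j₀ + 1)),
        Torus.vectorL2Sq (W t) ≤ C * Torus.vectorL2Sq (W (tStart j₀ + tHalf j₀)))
    (w₁ : UnitAddTorus (Fin 2) → EuclideanSpace ℝ (Fin 2))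
    (w : ℝ → UnitAddTorus (Fin 2) → EuclideanSpace ℝ (Fin 2)) (q : ℝ → UnitAddTorus (Fin 2) → ℝ)
    (hdat : ShearCombDatum (P.N j₀) true w₁)
    (hw : Torus.IsSmoothSpaceTimeOn (Icc (tStart j₀ + tHalf j₀) (tStart (j₀ + 1))) w)
    (hq : Torus.IsSmoothSpaceTimeOn (Icc (tStart j₀ + tHalf j₀) (tStart (j₀ + 1))) q)
    (hdiv : ∀ t ∈ Icc (tStart j₀ + tHalf j₀) (tStart (j₀ + 1)), Torus.IsDivFree (w t))
    (hlin : ∀ t ∈ Icc (tStart j₀ + tHalf j₀) (tStart (j₀ + 1)), ∀ x,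
      Torus.timeDerivWithin (Icc (tStart j₀ + tHalf j₀) (tStart (j₀ + 1))) w t x +
        Torus.convect (P.field t) (w t) x + Torus.convect (w t) (P.field t) x =
          ν • Torus.laplacian (w t) x - Torus.gradient (q t) x)
    (h0 : w (tStart j₀ + tHalf j₀) = w₁) :
    ∀ t ∈ Icc (tStart j₀ + tHalf j₀) (tStart (j₀ + 1)),
      Torus.vectorL2Sq (w t) ≤ C * Torus.vectorL2Sq w₁ := by
  intro t ht
  -- the comb in normal form
  obtain ⟨g, hg, hper, hmom, hw₁⟩ := hdat
  have hw₁' : w₁ = fun y : UnitAddTorus (Fin 2) => g (Torus.repr y 1) • EuclideanSpace.single (0 : Fin 2) (1 : ℝ) := by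
    rw [hw₁]; exact (parallel_true_eq g).symm
  -- the V pulse: smooth, divergence free, invariant along `e₁`
  set a : ℝ := tStart j₀ + tHalf j₀ with ha_def
  set b : ℝ := tStart (j₀ + 1) with hb_def
  have hab : a < b := tMid_lt_tStart_succ j₀
  have ha : a ∈ Icc a b := ⟨le_rfl, hab.le⟩
  have hu : Torus.IsSmoothSpaceTimeOn (Icc a b) P.field :=
    (cascadeFieldSmooth P hδ₀ hd).mono (Icc_V_subset_Ico j₀)
  have hudiv : ∀ s ∈ Icc a b, Torus.IsDivFree (P.field s) := fun s hs => P.isDivFree_field_of_mem_V hs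
  have hinv : ∀ s ∈ Icc a b, ∀ (c : UnitAddCircle) (x : UnitAddTorus (Fin 2)),
      P.field s (x + Pi.single (1 : Fin 2) c) = P.field s x :=
    fun s hs c x => P.field_add_single_one_of_mem_V hs c x
  -- the datum: zero mean, spectrum on the axis `ℤ e₁`
  have hwa : w a = fun y : UnitAddTorus (Fin 2) => g (Torus.repr y 1) • EuclideanSpace.single (0 : Fin 2) (1 : ℝ) := by
    rw [h0, hw₁']
  have hmean : Torus.HasZeroMean (w a) := by
    rw [hwa]; exact hasZeroMean_combH hg hper hmom hN
  have hax : ∀ k : Fin 2 → ℤ, k ≠ Pi.single 1 (k 1) →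
      mFourierCoeff (EuclideanSpace.complexify ∘ w a) k = 0 := by
    intro k hk
    rw [hwa]
    exact mFourierCoeff_combH_eq_zero_of_ne hg hper (apply_zero_ne_zero_of_ne_single hk)
  -- the reduction to single harmonics of the datum
  have hmain := Torus.linearisedNS_integral_norm_sq_le_of_forall_harmonic (d := Fin 2) (i := (1 : Fin 2))
    hν hab hu hudiv hinv hw hq hdiv hlin hmean hax hC ht ?_
  · -- `vectorL2Sq` is the integral of the squared norm
    have e1 : Torus.vectorL2Sq (w t) = ∫ x, ‖w t x‖ ^ 2 := rfl
    have e2 : Torus.vectorL2Sq w₁ = ∫ x, ‖w a x‖ ^ 2 := by rw [h0]; rfl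
    rw [e1, e2]
    exact hmain
  · intro l hl W Q hW hQ hWdiv hWlin hWa
    by_cases hodd : ∃ n : ℤ, (l : ℤ) = (2 * n + 1) * (P.N j₀ : ℤ)
    · -- a comb harmonic: the hypothesis, with the transversal vector `2 ŵ(a)(l e₁)`
      have hci := Torus.mFourierCoeff_single_apply_eq_zero_of_isDivFree (hw.isSmooth_slice ha) (hdiv a ha)
        (1 : Fin 2) (show (l : ℤ) ≠ 0 by exact_mod_cast (by omega : l ≠ 0))
      have hz1 : ((2 : ℂ) • mFourierCoeff (EuclideanSpace.complexify ∘ w a) (Pi.single 1 (l : ℤ))) 1 = 0 := by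
        simp [hci]
      have h := hH l hl hodd _ hz1 W Q hW hQ hWdiv hWlin hWa t ht
      have e1 : Torus.vectorL2Sq (W t) = ∫ x, ‖W t x‖ ^ 2 := rfl
      have e2 : Torus.vectorL2Sq (W a) = ∫ x, ‖W a x‖ ^ 2 := rfl
      rw [e1, e2] at h
      exact h
    · -- an absent harmonic: the datum is `0`, so is the solution
      have hcoef : mFourierCoeff (EuclideanSpace.complexify ∘ w a) (Pi.single 1 (l : ℤ)) = 0 := by
        rw [hwa]; exact mFourierCoeff_combH_single_eq_zero hg hper hmom hodd
      have hWa0 : W a = 0 := by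
        rw [hWa, hcoef, smul_zero]
        exact realTrigPoly_singleton_zero _
      have hWt : W t = 0 := Torus.linearisedNS_eq_zero hν.le hu hudiv hW hQ hWdiv hWlin hWa0 ht
      rw [hWt, hWa0]
      simp

/-! ## §3 Stub A verbatim from the single-harmonic bound on `γ ∈ (5.77, 8]` -/

/-- The box frequencies are non-zero: `N_{j₀} = ρN^{j₀} ≥ 1` for `ρN ∈ {2,…,7}`. -/
theorem boxN_ne_zero {γ : ℝ} {ρN : ℕ} (hρ : ρN ∈ Finset.Icc 2 7) (j₀ : ℕ) :
    (⟨γ, 1 / 4, 2, 1, ρN⟩ : CascadeParams).N j₀ ≠ 0 := by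
  have h2 : 2 ≤ ρN := (Finset.mem_Icc.mp hρ).1
  show 1 * ρN ^ j₀ ≠ 0
  rw [one_mul]
  exact pow_ne_zero _ (by omega)

/-- **`stub_injectionPhase` ⇐ the SINGLE-HARMONIC perpendicular-slot bound on the residual range
`γ ∈ (5.77, 8]`.**  If for every `γ ∈ (5.77, 8]`, `ρN ∈ {2,…,7}` there is `ν₀ > 0` such that for
`ν ∈ (0, ν₀]`, every phase `j₀`, every odd multiple `l = (2n+1)N_{j₀} ≥ 1` and every transversal `z ∈ ℂ²`
(`z₁ = 0`), every classical solution `(W, Q)` of the Navier–Stokes equations linearised at the cascade carrier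
on the V half-slot `[tStart j₀ + tHalf j₀, tStart (j₀+1)]` with `W (tStart j₀ + tHalf j₀) = Re (e_{l e₁} z)`
satisfies `‖W(t)‖² ≤ (3e^{σ⋆γ})² ‖W(tStart j₀ + tHalf j₀)‖²` on the slot, then the registered stub A of the
line `phase-cocycle` holds VERBATIM (`perpSlot_of_harmonics` + `injectionPhase_of_perpSlot_Ioc`). -/
theorem injectionPhase_of_harmonics
    (hH : ∀ γ ∈ Ioc (5.77 : ℝ) 8, ∀ ρN ∈ Finset.Icc 2 7, ∃ ν₀ : ℝ, 0 < ν₀ ∧ ∀ ν ∈ Ioc 0 ν₀, ∀ (j₀ : ℕ)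
      (l : ℕ), 1 ≤ l → (∃ n : ℤ, (l : ℤ) = (2 * n + 1) * (((⟨γ, 1 / 4, 2, 1, ρN⟩ : CascadeParams).N j₀ : ℕ) : ℤ)) →
      ∀ z : EuclideanSpace ℂ (Fin 2), z 1 = 0 →
      ∀ (W : ℝ → UnitAddTorus (Fin 2) → EuclideanSpace ℝ (Fin 2)) (Q : ℝ → UnitAddTorus (Fin 2) → ℝ),
      Torus.IsSmoothSpaceTimeOn (Icc (CascadeParams.tStart j₀ + CascadeParams.tHalf j₀)
        (CascadeParams.tStart (j₀ + 1))) W →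
      Torus.IsSmoothSpaceTimeOn (Icc (CascadeParams.tStart j₀ + CascadeParams.tHalf j₀)
        (CascadeParams.tStart (j₀ + 1))) Q →
      (∀ s ∈ Icc (CascadeParams.tStart j₀ + CascadeParams.tHalf j₀) (CascadeParams.tStart (j₀ + 1)),
        Torus.IsDivFree (W s)) →
      (∀ s ∈ Icc (CascadeParams.tStart j₀ + CascadeParams.tHalf j₀) (CascadeParams.tStart (j₀ + 1)), ∀ x,
        Torus.timeDerivWithin (Icc (CascadeParams.tStart j₀ + CascadeParams.tHalf j₀)
            (CascadeParams.tStart (j₀ + 1))) W s x +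
          Torus.convect ((⟨γ, 1 / 4, 2, 1, ρN⟩ : CascadeParams).field s) (W s) x +
          Torus.convect (W s) ((⟨γ, 1 / 4, 2, 1, ρN⟩ : CascadeParams).field s) x =
          ν • Torus.laplacian (W s) x - Torus.gradient (Q s) x) →
      W (CascadeParams.tStart j₀ + CascadeParams.tHalf j₀) =
        Torus.realTrigPoly {Pi.single 1 (l : ℤ)} (fun _ => z) →
      ∀ t ∈ Icc (CascadeParams.tStart j₀ + CascadeParams.tHalf j₀) (CascadeParams.tStart (j₀ + 1)),
        Torus.vectorL2Sq (W t) ≤ (3 * Real.exp (sawSigmaStar * γ)) ^ 2 *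
          Torus.vectorL2Sq (W (CascadeParams.tStart j₀ + CascadeParams.tHalf j₀))) :
    ∀ γ ∈ Icc (4 : ℝ) 8, ∀ ρN ∈ Finset.Icc 2 7, ∃ ν₀ : ℝ, 0 < ν₀ ∧ ∀ ν ∈ Ioc 0 ν₀, ∀ (j₀ : ℕ) (hz : Bool)
      (w₀ : UnitAddTorus (Fin 2) → EuclideanSpace ℝ (Fin 2))
      (w : ℝ → UnitAddTorus (Fin 2) → EuclideanSpace ℝ (Fin 2)) (q : ℝ → UnitAddTorus (Fin 2) → ℝ),
      ShearCombDatum ((⟨γ, 1 / 4, 2, 1, ρN⟩ : CascadeParams).N j₀) hz w₀ →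
      Torus.IsSmoothSpaceTimeOn (Icc (CascadeParams.tInject j₀ hz) (CascadeParams.tStart (j₀ + 1))) w →
      Torus.IsSmoothSpaceTimeOn (Icc (CascadeParams.tInject j₀ hz) (CascadeParams.tStart (j₀ + 1))) q →
      (∀ t ∈ Icc (CascadeParams.tInject j₀ hz) (CascadeParams.tStart (j₀ + 1)), Torus.IsDivFree (w t)) →
      (∀ t ∈ Icc (CascadeParams.tInject j₀ hz) (CascadeParams.tStart (j₀ + 1)), ∀ x,
        Torus.timeDerivWithin (Icc (CascadeParams.tInject j₀ hz) (CascadeParams.tStart (j₀ + 1))) w t x +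
          Torus.convect ((⟨γ, 1 / 4, 2, 1, ρN⟩ : CascadeParams).field t) (w t) x +
          Torus.convect (w t) ((⟨γ, 1 / 4, 2, 1, ρN⟩ : CascadeParams).field t) x =
          ν • Torus.laplacian (w t) x - Torus.gradient (q t) x) →
      w (CascadeParams.tInject j₀ hz) = w₀ →
      ∀ t ∈ Icc (CascadeParams.tInject j₀ hz) (CascadeParams.tStart (j₀ + 1)),
        Torus.vectorL2Sq (w t) ≤ (3 * Real.exp (sawSigmaStar * γ)) ^ 2 * Torus.vectorL2Sq w₀ := by
  refine injectionPhase_of_perpSlot_Ioc fun γ hγ ρN hρ => ?_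
  obtain ⟨ν₀, hν₀, H⟩ := hH γ hγ ρN hρ
  refine ⟨ν₀, hν₀, fun ν hν j₀ w₁ w' q' hdat hw hq hdiv hlin h0 => ?_⟩
  exact perpSlot_of_harmonics ⟨γ, 1 / 4, 2, 1, ρN⟩ (by norm_num) (by norm_num) hν.1 j₀ (boxN_ne_zero hρ j₀)
    (sq_nonneg _) (H ν hν j₀) w₁ w' q' hdat hw hq hdiv hlin h0

end Summit.AnomalousDissipation.AnomalousDissipation.Theorems.SawtoothPulseCascade.K2Classical

end
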